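import Mathlib
import HarnessLib
import Summits.AtomisticToContinuum.FouriersLaw.Theses.HoelderEscapeProfile
import Summits.AtomisticToContinuum.FouriersLaw.Theorems.HoelderEscapeProfileAbelThermodynamicLimitOfEngine

/-!
# (A⁻) on route HoelderEscapeProfile needs only K1 ∧ K2 (∧ the fibre calculus): the corner FLOOR without ceiling or Abel regularity
(crux stmt-AtomisticToContinuum-11749 `ConductanceLowerBound`, line `abel-floor-exchange`, lead c6; `--supports`, closes nothing)

Lead seat 12596-c22 recorded (`Theorems/HoelderEscapeProfileAbelThermodynamicLimitOfEngine.lean`) that the full ENGINE of route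
HoelderEscapeProfile — `LocalEnergyHalfHoelder` (K1), `CornerNoDip` (K2), `AbelSpreadCeiling`, `AbelRegularity`, `FibreCalculus`,
`SymmetricSetup` — yields a shift-invariant Abelian Green–Kubo witness and hence the bulk Abel floor behind stub (A⁻)
`stub_openChainAbelFloor` of line `abel-floor-exchange`.  For the FLOOR (as opposed to the existence of the Abelian limit) the two
finiteness/regularity inputs are idle: inside the `corner` lemma of `HoelderEscapeProfile.closes` the lower bound
`c₁ = χ³/(512π²C'²) ≤ A(ν)` (pigeonhole in `k` + ½-Hölder on-site return + no corner dip) uses neither the spread ceiling nor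
non-oscillation.  This file isolates that half:

* `cornerFloor` — the pure real-analysis floor: `∃ c₁ ν₃ > 0, ∀ ν ∈ (0, ν₃), c₁ ≤ A ν`.
* `bulkAbelFloor_of_hoelderCorner` — K1 → K2 → FibreCalculus → SymmetricSetup → bulk Abel-floor witness (shift-invariant DLR
  state, preserving dynamics with absolutely convergent correlations, `a, ν₀ > 0`, `a ≤ ∫₀^∞e^{−νt}C_T` on `(0, ν₀)`).
* `conductanceLowerBound_of_hoelderCorner` — K1 → K2 → FibreCalculus → SymmetricSetup → `UniformAbelianRegularity` (stmt-13416) →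
  `HoelderEscapeProfile.ConductanceLowerBound`, by the landed bridges of the line (`abelFloor_openChain_of_bulkWitness`,
  `slowRegularity_signed_of_uniformAbelianRegularity`, `conductanceLowerBound_of_abelFloor_and_signedSlowRegularity`, p156938).

So on HoelderEscapeProfile the open cone of the child stmt-11749 is {K1 stmt-16008, K2 stmt-16009, FibreCalculus stmt-16011,
stmt-13416} (`SymmetricSetup` stmt-11036 is proved): the positivity half of the route does not wait for `AbelSpreadCeiling`
(stmt-16010, open-problem) or `AbelRegularity` (stmt-15384).  References: Guarneri 1989 / Last 1996 (the transplanted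
inequality), Helfand 1960, Kundu–Dhar–Narayan 2009.  No definitions, no named facts, no sorry.
-/

noncomputable section

open MeasureTheory Filter Set Topology
open scoped Topology
open Literature.MathematicalPhysics.KineticTheory.HeatConduction
open Summit.AtomisticToContinuum.FouriersLaw.Theses.HoelderEscapeProfile
open Summit.AtomisticToContinuum.FouriersLaw.Theorems.AbelThermodynamicLimit.HoelderEngine

namespace Summit.AtomisticToContinuum.FouriersLaw.Cruxes.ConductanceLowerBound.AbelFloorExchange

/-- **The corner FLOOR (lower half of the `corner` lemma of `HoelderEscapeProfile.closes`, without ceiling or regularity).**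
With `χ = χk 0 > 0` continuous at `0`, Bochner `fh ν ≥ 0`, conservation `fh ν 0 = χ`, Parseval `∫_{−π}^{π} fh ν = 2πΨ(ν)`, the
½-Hölder return `Ψ(ν) ≤ C√ν` (`0 < ν ≤ ν₀`), the `k`-space conservation law `χk k − fh ν k = (2 − 2cos k)·Gh ν k/ν`, `A ν = Gh ν 0`
and no corner dip of `Gh`: there are `c₁, ν₃ > 0` with `c₁ ≤ A ν` for all `ν ∈ (0, ν₃)` (`c₁ = χ³/(512π²·max(C,1)²)`).
[cite: Last1996, Thm 1] -/
theorem cornerFloor : ∀ (A Ψ χk : ℝ → ℝ) (fh Gh : ℝ → ℝ → ℝ) (C ν₀ : ℝ),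
    0 < χk 0 → ContinuousAt χk 0 → (∀ ν, 0 < ν → Continuous (fh ν)) →
    (∀ ν, 0 < ν → fh ν 0 = χk 0) → (∀ ν, 0 < ν → ∀ k, 0 ≤ fh ν k) →
    (∀ ν, 0 < ν → ∫ k in (-Real.pi)..Real.pi, fh ν k = 2 * Real.pi * Ψ ν) →
    0 < ν₀ → (∀ ν, 0 < ν → ν ≤ ν₀ → Ψ ν ≤ C * Real.sqrt ν) →
    (∀ ν, 0 < ν → ∀ k, χk k - fh ν k = (2 - 2 * Real.cos k) * Gh ν k / ν) →
    (∀ ν, 0 < ν → A ν = Gh ν 0) →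
    (∀ a : ℝ, 0 < a → ∀ ε : ℝ, 0 < ε → ∃ ν₂ : ℝ, 0 < ν₂ ∧ ∀ ν, 0 < ν → ν ≤ ν₂ →
      ∀ k, |k| ≤ a * Real.sqrt ν → Gh ν k ≤ Gh ν 0 + ε) →
    ∃ c₁ ν₃ : ℝ, 0 < c₁ ∧ 0 < ν₃ ∧ ∀ ν, 0 < ν → ν < ν₃ → c₁ ≤ A ν := by
  intro A Ψ χk fh Gh C ν₀ hχ hχc hfc hf0 hfn hfi hν₀ hK1 hid hA hND
  set χ := χk 0 with hχdef
  set C' := max C 1 with hC'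
  have hC'p : 0 < C' := lt_of_lt_of_le one_pos (le_max_right _ _)
  set a := 8 * Real.pi * C' / χ with ha
  have hap : 0 < a := by positivity
  set c₁ := χ ^ 3 / (512 * Real.pi ^ 2 * C' ^ 2) with hc₁
  have hc₁p : 0 < c₁ := by positivity
  obtain ⟨ν₂, hν₂, hND'⟩ := hND a hap c₁ hc₁p
  obtain ⟨δ, hδ, hδχ⟩ : ∃ δ > 0, ∀ k, |k| < δ → |χk k - χ| < χ / 4 := by
    obtain ⟨δ, hδ, h⟩ := Metric.continuousAt_iff.mp hχc (χ / 4) (by positivity)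
    exact ⟨δ, hδ, fun k hk => by simpa [Real.dist_eq] using h (by simpa [Real.dist_eq] using hk)⟩
  have hlow : ∀ ν, 0 < ν → ν ≤ ν₀ → ν ≤ ν₂ → a * Real.sqrt ν < δ → a * Real.sqrt ν ≤ Real.pi →
      c₁ ≤ A ν := by
    intro ν hν h0 h2 hKδ hKπ
    set K := a * Real.sqrt ν with hK
    have hsq : 0 < Real.sqrt ν := Real.sqrt_pos.mpr hν
    have hKp : 0 < K := mul_pos hap hsq
    have hΨ : Ψ ν ≤ C' * Real.sqrt ν := (hK1 ν hν h0).trans (mul_le_mul_of_nonneg_right (le_max_left _ _) hsq.le)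
    obtain ⟨k, ⟨hk0, hkK⟩, hfk⟩ : ∃ k ∈ Ioc (0:ℝ) K, fh ν k ≤ χ / 2 := by
      by_contra H
      push Not at H
      have hge : ∀ k ∈ Icc (0:ℝ) K, χ / 2 ≤ fh ν k := fun k hk => by
        rcases eq_or_lt_of_le hk.1 with h | h
        · rw [← h, hf0 ν hν]; linarith
        · exact (H k ⟨h, hk.2⟩).le
      have h1 : ∫ k in (0:ℝ)..K, (χ / 2 : ℝ) ≤ ∫ k in (0:ℝ)..K, fh ν k :=
        intervalIntegral.integral_mono_on hKp.le (by simp) ((hfc ν hν).intervalIntegrable _ _) hge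
      rw [intervalIntegral.integral_const, smul_eq_mul, sub_zero] at h1
      have h2 : ∫ k in (0:ℝ)..K, fh ν k ≤ ∫ k in (-Real.pi)..Real.pi, fh ν k :=
        intervalIntegral.integral_mono_interval (neg_nonpos.mpr Real.pi_pos.le) hKp.le hKπ
          (Eventually.of_forall fun k => hfn ν hν k) ((hfc ν hν).intervalIntegrable _ _)
      rw [hfi ν hν] at h2
      have h3 : K * (χ / 2) = 4 * Real.pi * C' * Real.sqrt ν := by rw [hK, ha]; field_simp; ring
      have h4 : 0 < Real.pi * C' * Real.sqrt ν := by positivity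
      nlinarith [h1, h2, hΨ, Real.pi_pos]
    have hc1 : Real.cos k < 1 := by
      have := Real.cos_lt_cos_of_nonneg_of_le_pi le_rfl (hkK.trans hKπ) hk0; rwa [Real.cos_zero] at this
    set d := 2 - 2 * Real.cos k with hd
    have hdp : 0 < d := by rw [hd]; linarith
    have hdk : d ≤ a ^ 2 * ν := by
      have e1 := Real.one_sub_sq_div_two_le_cos (x := k)
      have e2 : k ^ 2 ≤ K ^ 2 := pow_le_pow_left₀ hk0.le hkK 2
      rw [hK, mul_pow, Real.sq_sqrt hν.le] at e2; rw [hd]; linarith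
    have hχk : 3 * χ / 4 ≤ χk k := by
      have := hδχ k (by rw [abs_of_pos hk0]; exact lt_of_le_of_lt hkK hKδ)
      rw [abs_lt] at this; linarith [this.1]
    have hpr : χ / 4 * ν ≤ d * Gh ν k := by
      have e : (χk k - fh ν k) * ν = d * Gh ν k := by rw [hid ν hν k, hd]; field_simp
      rw [← e]; exact mul_le_mul_of_nonneg_right (by linarith) hν.le
    have hG2 : 2 * c₁ ≤ Gh ν k := by
      have e2 : χ / 4 * ν / d ≤ d * Gh ν k / d := div_le_div_of_nonneg_right hpr hdp.le
      have e2' : d * Gh ν k / d = Gh ν k := by field_simp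
      have e3 : χ / 4 * ν / (a ^ 2 * ν) ≤ χ / 4 * ν / d := div_le_div_of_nonneg_left (by positivity) hdp hdk
      have e4 : χ / 4 * ν / (a ^ 2 * ν) = 2 * c₁ := by rw [ha, hc₁]; field_simp; ring
      linarith
    have := hND' ν hν h2 k (by rw [abs_of_pos hk0]; exact hkK)
    rw [hA ν hν]; linarith
  -- an explicit right-neighbourhood of 0 on which all side conditions hold
  set m := min δ Real.pi with hm
  have hmp : 0 < m := lt_min hδ Real.pi_pos
  set ν₃ := min (min ν₀ ν₂) ((m / a) ^ 2 / 4) with hν₃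
  have hν₃p : 0 < ν₃ := by positivity
  refine ⟨c₁, ν₃, hc₁p, hν₃p, fun ν hν hlt => ?_⟩
  have h0 : ν ≤ ν₀ := (hlt.le.trans (min_le_left _ _)).trans (min_le_left _ _)
  have h2 : ν ≤ ν₂ := (hlt.le.trans (min_le_left _ _)).trans (min_le_right _ _)
  have h3 : ν < (m / a) ^ 2 / 4 := lt_of_lt_of_le hlt (min_le_right _ _)
  have hma : 0 < m / a := by positivity
  have hsqrt : Real.sqrt ν < m / a := by
    have h4 : ν < (m / a) ^ 2 := by nlinarith [sq_nonneg (m / a)]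
    calc Real.sqrt ν < Real.sqrt ((m / a) ^ 2) := Real.sqrt_lt_sqrt hν.le h4
      _ = m / a := Real.sqrt_sq hma.le
  have hK : a * Real.sqrt ν < m := by
    have := mul_lt_mul_of_pos_left hsqrt hap
    rwa [mul_div_cancel₀ _ hap.ne'] at this
  exact hlow ν hν h0 h2 (lt_of_lt_of_le hK (min_le_left _ _)) (hK.le.trans (min_le_right _ _))

/-- **BULK ABEL FLOOR ON HoelderEscapeProfile FROM K1 ∧ K2 ALONE (given the fibre calculus and the symmetric setup).**  For
`ω₂, lam, β, γ > 0` and `T > 0`: a shift-invariant DLR state `μ_T`, a `μ_T`-preserving dynamics with absolutely convergent current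
correlations and `a, ν₀ > 0` with `a ≤ ∫₀^∞ e^{−νt} C_T(t) dt` for `ν ∈ (0, ν₀)` — the witness shape consumed by
`abelFloor_openChain_of_bulkWitness`.  Neither `AbelSpreadCeiling` nor `AbelRegularity` is used. [cite: Helfand1960, eq. (3.10)] -/
theorem bulkAbelFloor_of_hoelderCorner
    (hK1 : LocalEnergyHalfHoelder) (hND : CornerNoDip) (hFC : FibreCalculus) (hSet : SymmetricSetup) :
    ∀ ω₂ lam β γ : ℝ, 0 < ω₂ → 0 < lam → 0 < β → 0 < γ → ∀ T : ℝ, 0 < T →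
      ∃ (μT : Measure ChainConfig) (D : InfiniteChainDynamics (pinnedChain ω₂ lam β γ)) (a ν₀ : ℝ),
        (pinnedChain ω₂ lam β γ).IsChainGibbsMeasure T μT ∧ IsShiftInvariant μT ∧
        D.PreservesMeasure μT ∧ (∀ t : ℝ, D.HasAbsConvergentCorrelation μT t) ∧ 0 < a ∧ 0 < ν₀ ∧
        ∀ ν : ℝ, 0 < ν → ν < ν₀ →
          a ≤ ∫ t in Set.Ioi (0:ℝ), Real.exp (-(ν * t)) * D.currentCorrelation μT t := by
  intro ω₂ lam β γ hω hl hβ _hγ T hT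
  set P := Literature.MathematicalPhysics.KineticTheory.HeatConduction.pinnedChain ω₂ lam β γ with hPdef
  obtain ⟨μT, hG, hSI, hRefl, D, hP, hShift⟩ := hSet ω₂ lam β γ hω hl hβ T hT
  set h : Literature.MathematicalPhysics.KineticTheory.HeatConduction.ChainConfig → ℤ → ℝ :=
    fun σ x => (σ x).2 ^ 2 / 2 + P.U (σ x).1 + (P.V ((σ (x + 1)).1 - (σ x).1) + P.V ((σ x).1 - (σ (x - 1)).1)) / 2 with hh
  set S : ℤ → ℝ → ℝ := fun x t => ∫ σ, (h σ 0 - ∫ σ', h σ' 0 ∂μT) * (h (D.flow t σ) x - ∫ σ', h σ' 0 ∂μT) ∂μT with hS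
  set Sb : ℝ → ℤ → ℝ := fun ν x => ν * ∫ t in Set.Ioi (0:ℝ), Real.exp (-(ν * t)) * S x t with hSb
  set G : ℤ → ℝ → ℝ := fun x t => ∫ σ, P.bondCurrentZ σ 0 * P.bondCurrentZ (D.flow t σ) x ∂μT with hGd
  set Gh : ℝ → ℝ → ℝ := fun ν k => ∫ t in Set.Ioi (0:ℝ), Real.exp (-(ν * t)) * ∑' x : ℤ, Real.cos (k * (x : ℝ)) * G x t
    with hGh
  set fh : ℝ → ℝ → ℝ := fun ν k => ∑' x : ℤ, Real.cos (k * (x : ℝ)) * Sb ν x with hfh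
  set χk : ℝ → ℝ := fun k => ∑' x : ℤ, Real.cos (k * (x : ℝ)) * S x 0 with hχk
  obtain ⟨hAC, -, hIntS, hSumSb, hSumS0, hχpos, hcons, hBoch, hPars, hIntG, hId, -⟩ :=
    hFC ω₂ lam β γ hω hl hβ T hT μT hG hSI hRefl D hP hShift h hh S hS Sb hSb G hGd Gh hGh fh hfh χk hχk
  obtain ⟨C, ν₀, hν₀, hK1'⟩ := hK1 ω₂ lam β γ hω hl hβ T hT μT hG hSI hRefl D hP hShift h hh S hS (hIntS 0)
  obtain ⟨c₁, ν₃, hc₁, hν₃, hfloor⟩ := cornerFloor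
    (fun ν => ∫ t in Set.Ioi (0:ℝ), Real.exp (-(ν * t)) * D.currentCorrelation μT t)
    (fun ν => Sb ν 0) χk fh Gh C ν₀
    hχpos (by rw [hχk]; exact (cosSeries _ hSumS0).continuousAt)
    (fun ν hν => by rw [hfh]; exact cosSeries _ (hSumSb ν hν))
    (fun ν hν => by simp only [hfh, zero_mul, Real.cos_zero, one_mul]; exact hcons ν hν)
    hBoch hPars hν₀ hK1' hId (fun ν hν => by simp only [hGh, hGd, zero_mul, Real.cos_zero, one_mul]; rfl)
    (hND ω₂ lam β γ hω hl hβ T hT μT hG hSI hRefl D hP hShift G hGd Gh hGh hAC hIntG)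
  exact ⟨μT, D, c₁, ν₃, hG, hSI, hP, hAC, hc₁, hν₃, fun ν hν hlt => hfloor ν hν hlt⟩

/-- **`HoelderEscapeProfile.ConductanceLowerBound` from K1, K2, the fibre calculus, the symmetric setup and the sibling (R).**
On route HoelderEscapeProfile the child stmt-11749 follows from `LocalEnergyHalfHoelder`, `CornerNoDip`, `FibreCalculus`,
`SymmetricSetup` and `UniformAbelianRegularity` (stmt-13416; only its lower half is used) — without `AbelSpreadCeiling` and without
`AbelRegularity` — by the landed bridges of line `abel-floor-exchange`. [cite: KunduDharNarayan2009, p. 3] -/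
theorem conductanceLowerBound_of_hoelderCorner :
    Summit.AtomisticToContinuum.FouriersLaw.Theses.HoelderEscapeProfile.LocalEnergyHalfHoelder →
    Summit.AtomisticToContinuum.FouriersLaw.Theses.HoelderEscapeProfile.CornerNoDip →
    Summit.AtomisticToContinuum.FouriersLaw.Theses.HoelderEscapeProfile.FibreCalculus →
    Summit.AtomisticToContinuum.FouriersLaw.Theses.HoelderEscapeProfile.SymmetricSetup →
    Summit.AtomisticToContinuum.FouriersLaw.Theses.HoelderEscapeProfile.UniformAbelianRegularity →
    Summit.AtomisticToContinuum.FouriersLaw.Theses.HoelderEscapeProfile.ConductanceLowerBound :=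
  fun hK1 hND hFC hSet hR =>
  conductanceLowerBound_of_abelFloor_and_signedSlowRegularity
    (abelFloor_openChain_of_bulkWitness (bulkAbelFloor_of_hoelderCorner hK1 hND hFC hSet))
    (slowRegularity_signed_of_uniformAbelianRegularity hR)

end Summit.AtomisticToContinuum.FouriersLaw.Cruxes.ConductanceLowerBound.AbelFloorExchange

end
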